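import Mathlib
import Summits.Ventures.PercRepro2.TypedSpectator
import Summits.Ventures.PercRepro2.OneTypedEdge

/-!
# The root symmetry of the typed bases (blind cell PercRepro2, night-3 g5, 2026-08-25;
`proofs/NIGHT3-CERT.md` §14.8)

The kernel `K₃` is invariant under exchanging the two roots `a₁ ↔ a₂`: every term carries an even
number of side signs `σ`, the other factors (`1_Q`, `1_PD`, `1_{v ∈ U}`) are symmetric.  On states
this is `KB_swapSt` (`swapSt` exchanges the `L`- and `H`-coordinates); through `st` it gives
`K3_swap_roots` and `typedCount_swap_roots`: every typed base of row 2′TRI is symmetric in the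
roots.  Used for the mirror placement of the separated class.
-/

namespace Summit.Ventures.PercRepro2

open UnionCluster

namespace CovForm

namespace SwapRoots

open OneTyped

section States

/-- Exchange the `L`- and `H`-coordinates of a state. -/
def swapSt (s : St) : St := (s.q', s.Ho, s.Lo, s.Hb, s.Lb, s.H3, s.L3)

/-- The side sign changes sign under the exchange. -/
lemma sigB_comm (L H : Bool) : sigB H L = -sigB L H := by
  cases L <;> cases H <;> rfl

/-- `1_{v ∈ U}` is symmetric. -/
lemma uB_comm (L H : Bool) : uB H L = uB L H := by
  cases L <;> cases H <;> rfl

/-- `1_{PD}` is symmetric. -/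
lemma pdB_swapSt (s : St) : pdB (swapSt s) = pdB s := by
  obtain ⟨q, Lo, Ho, Lb, Hb, L3, H3⟩ := s
  cases q <;> cases L3 <;> cases H3 <;> rfl

/-- `1_Q` is symmetric. -/
lemma qB_swapSt (s : St) : qB (swapSt s) = qB s := rfl

/-- Coordinates of the exchanged state. -/
lemma swapSt_Lo (s : St) : (swapSt s).Lo = s.Ho := rfl
/-- Coordinates of the exchanged state. -/
lemma swapSt_Ho (s : St) : (swapSt s).Ho = s.Lo := rfl
/-- Coordinates of the exchanged state. -/
lemma swapSt_Lb (s : St) : (swapSt s).Lb = s.Hb := rfl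
/-- Coordinates of the exchanged state. -/
lemma swapSt_Hb (s : St) : (swapSt s).Hb = s.Lb := rfl
/-- Coordinates of the exchanged state. -/
lemma swapSt_L3 (s : St) : (swapSt s).L3 = s.H3 := rfl
/-- Coordinates of the exchanged state. -/
lemma swapSt_H3 (s : St) : (swapSt s).H3 = s.L3 := rfl

/-- The side sign of `o` at the exchanged coordinates. -/
lemma sigB_swap_o (s : St) : sigB s.Ho s.Lo = -sigB s.Lo s.Ho := sigB_comm _ _
/-- The side sign of `b` at the exchanged coordinates. -/
lemma sigB_swap_b (s : St) : sigB s.Hb s.Lb = -sigB s.Lb s.Hb := sigB_comm _ _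
/-- The side sign of `a₃` at the exchanged coordinates. -/
lemma sigB_swap_3 (s : St) : sigB s.H3 s.L3 = -sigB s.L3 s.H3 := sigB_comm _ _
/-- `1_{o ∈ U}` at the exchanged coordinates. -/
lemma uB_swap_o (s : St) : uB s.Ho s.Lo = uB s.Lo s.Ho := uB_comm _ _
/-- `1_{b ∈ U}` at the exchanged coordinates. -/
lemma uB_swap_b (s : St) : uB s.Hb s.Lb = uB s.Lb s.Hb := uB_comm _ _

/-- **The kernel on states is symmetric in the roots.** -/
theorem KB_swapSt (x y z : St) : KB (swapSt x) (swapSt y) (swapSt z) = KB x y z := by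
  unfold KB
  simp only [pdB_swapSt, qB_swapSt, swapSt_Lo, swapSt_Ho, swapSt_Lb, swapSt_Hb, swapSt_L3,
    swapSt_H3, sigB_swap_o, sigB_swap_b, sigB_swap_3, uB_swap_o, uB_swap_b]
  ring

end States

section Main

open Classical

variable {V : Type*} {E : Type*} [Fintype E] [DecidableEq E] {R : Type*} [Field R]
variable (ends : E → Sym2 V) (o a₁ a₂ a₃ b : V)

omit [Fintype E] [DecidableEq E] in
/-- The state with the roots exchanged is the exchanged state. -/
lemma st_swap_roots (x : Config E) :
    st ends o a₂ a₁ a₃ b x = swapSt (st ends o a₁ a₂ a₃ b x) := by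
  unfold st swapSt
  simp only [St.q', St.Lo, St.Ho, St.Lb, St.Hb, St.L3, St.H3]
  rw [decide_eq_decide.mpr (show Conn ends x a₁ a₂ ↔ Conn ends x a₂ a₁ from ⟨conn_symm, conn_symm⟩)]

omit [Fintype E] [DecidableEq E] in
/-- **`K₃` is symmetric in the roots.** -/
theorem K3_swap_roots (x y w : Config E) :
    (K3 ends o a₂ a₁ a₃ b x y w : R) = K3 ends o a₁ a₂ a₃ b x y w := by
  rw [K3_eq_KB, K3_eq_KB, st_swap_roots ends o a₁ a₂ a₃ b x, st_swap_roots ends o a₁ a₂ a₃ b y,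
    st_swap_roots ends o a₁ a₂ a₃ b w, KB_swapSt]

/-- **Every typed base is symmetric in the roots.** -/
theorem typedCount_swap_roots (F : Finset E) (z : Config E) (τ : E → ℕ) :
    typedCount F z τ (K3 ends o a₂ a₁ a₃ b : Config E → Config E → Config E → R) =
      typedCount F z τ (K3 ends o a₁ a₂ a₃ b : Config E → Config E → Config E → R) :=
  TypedA3.typedCount_congr' _ _ _ _ _ fun x y w => K3_swap_roots ends o a₁ a₂ a₃ b x y w

end Main

end SwapRoots

end CovForm

end Summit.Ventures.PercRepro2
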